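import Mathlib
import Summits.Ventures.LatticeQCDFlow.Scaling.BarriersEntropy
import Summits.Ventures.LatticeQCDFlow.Scaling.EntropyBudgetBetween

/-!
# LatticeQCDFlow / Scaling — barrier supplement v2.7 (b): the capacity law BETWEEN COUPLINGS

HONEST FRAMING: exact (Metropolis-corrected) sampling algorithms for lattice gauge theory;
figures of merit are autocorrelation/cost numbers at stated couplings and volumes; no
continuum-physics claim.

THEORY-2.md §5.10 supplement (theory seat GEN-12; §3.2 (h17)).  One PROVED supplement to the T4
entry `ExactnessVsExpressivity` (THEORY-2.md §5.3) and to `EntropyBudgetLaw` / `MeanContractionLaw`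
(`Scaling/BarriersEntropy.lean`), in the docstring format of `Scaling/Barriers.lean`
(`technique_class` · `blocks` · `because` · `evasions_known` · `scope_caveats` · `nearest_prior_art`
· `status`): the entropy ⇒ ESS budget for flows pushed from a THERMALISED `β₀`-ENSEMBLE, in MEASURE
form on the lattice `(ℤ/L)^d`, for `SU(N)` with NO hypothesis left — the item that
`EntropyBudgetLaw.evasions_known (i)` ("heat-bath / HMC-thermalised prior at nearby `β₀`: capacity
`(n_tr/2)·log(β/β₀) + O(V)`") describes in words and `MeanContractionLaw` gives in MEAN form on a
finite space.  The barrier NAMES of record are unchanged.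
-/

noncomputable section

namespace Summit.Ventures.LatticeQCDFlow.Barriers

open MeasureTheory
open Literature.MathematicalPhysics.QuantumLattice Literature.MathematicalPhysics.QuantumFieldTheory

/-- **Supplement (CapacityRatioLaw) to ExactnessVsExpressivity / EntropyBudgetLaw — the capacity
law BETWEEN COUPLINGS, measure form, `SU(N)`.**  For every `d` and every `N ≥ 1` there is
`C = C(d, N)` such that for all `L ≥ 2`, `β₀ ≥ 1`, `β ≥ 1` and EVERY model on
`GaugeConfig d L SU(N)` with a measurable density `0 < g ≤ J / Z_Λ(β₀)` against product Haar — in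
particular the push-forward of the thermalised Wilson ensemble at `β₀` (density `≤ Z_Λ(β₀)⁻¹`,
`Theory2.Lattice.rnDeriv_wilsonMeasure_le`) under any flow whose inverse Jacobian is `≤ J` — the
exact (reweighted / independence-Metropolis) sampler of the Wilson measure at `β` has
`ESS ≤ J · e^{C·L^d} · β₀^{(N²−1)((d−1)L^d+1)/2} · β^{−(N²−1)((d−1)L^d(1/2−1/L) − 1/2)}`, i.e.
`log J + log(1/ESS) ≥ ((N²−1)(d−1)L^d/2)·log(β/β₀) − (N²−1)((d−1)L^d/L + 1/2)·log β −
((N²−1)/2)·log β₀ − C·L^d`.  Reading: the Jacobian CAPACITY (total log-volume contraction available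
somewhere in configuration space) that an exact flow sampler from a `β₀`-ensemble must supply is
`(n_tr/2)·log(β/β₀)` with `n_tr = (N²−1)(d−1)L^d` — EXTENSIVE in the volume, logarithmic in the
coupling RATIO — or the ESS pays for the shortfall nat for nat; for `SU(3)`, `d = 4`:
`12·L⁴·log(β/β₀)` to leading order.  With `J = 1` (Haar-preserving rearrangements of the
`β₀`-ensemble, any depth) the ESS is exponentially small in `L^d` once `log(β/β₀)` exceeds the
per-site slack.
technique_class: deterministic flows of any architecture and depth between two couplings
  `β₀ < β` of the same lattice (β-ladders rung by rung, "transfer" flows, flows refining an HMC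
  ensemble), used with exact reweighting or independence Metropolis; equally any proposal whose
  density against product Haar is bounded by `J/Z_Λ(β₀)`.
blocks: "a flow between nearby couplings only has to be close to the identity, so its cost does
  not grow with the volume" — the log-det budget is `Θ(L^d·log(β/β₀))` at every fixed ratio;
  volume-transfer of a fixed-capacity architecture trained at small `L` (capacity `log J` fixed ⇒
  `log(1/ESS) ≳ (n_tr/2)·log(β/β₀) − log J − O(L^d)` grows linearly in `L^d`); per-layer-clamped
  coupling architectures (`log J ≤ n·ℓ·V_a`, `Scaling/EntropyBudgetCoupling.lean`) of depth
  `n = o(log(β/β₀)/ℓ)`.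
because: PROVED — `Theory2.Lattice.SUN.essM_between_law` (`Scaling/EntropyBudgetBetween.lean`):
  `essM ≤ (J/Z(β₀))·exp(−D(μ_β‖Haar))` (`wilson_essM_le`, [Liu, Monte Carlo Strategies §2.5.3;
  arXiv:1511.06196 Thm 2.1]) + the entropy-growth lower bound `D(μ_β‖Haar) ≥ (N²−1)((d−1)L^d(1/2 −
  1/L) − 1/2)·log β − cL^d` (`SUN.entropyGrowthLaw`: peeling + one-plaquette Laplace bound) + the
  tree-gauge free-energy lower bound `log Z_Λ(β₀) ≥ −(N²−1)((d−1)L^d+1)/2·log β₀ − C'L^d`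
  (`log_partitionFunction_ge_of_smallBalls`: `SUN.smallBalls` + `treeGaugeSmallBallBound`).
evasions_known: none in kind — it is an inequality every exact sampler satisfies; lines "evade" it
  only by PAYING it: (i) genuinely contracting layers supplying `log J ≈ (n_tr/2)·log(β/β₀)` (few
  unboundedly-contracting layers, or `Θ(log(β/β₀)/ℓ)` clamped ones); (ii) many rungs with small
  ratios (the budgets add up to the same total `(n_tr/2)·log(β/β₀)`); (iii) STOCHASTIC flows /
  annealing between the couplings, which are not deterministic maps and pay in dissipated work on
  path space instead (`Barriers.AnnealingStepLaw`, `AnnealingWorkLaw`; measured `n_step ∝ (L/a)⁴` at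
  fixed KL [arXiv:2412.00200 §4.2, App. A]).
scope_caveats: necessary, not sufficient (capacity certifies nothing; T2-A / T2-I price every
  defect); finite lattice, `β₀, β ≥ 1`, `L ≥ 2`; the `(L^d/L)·log β` leak and the `O(L^d)`
  constant are the known slack of the entropy-growth law (boundary plaquettes of the tree gauge,
  non-asymptotic ball constants) — at today's couplings (`SU(3)`, `β = 6`, `β₀ = 5.7`) the per-dof
  budget `(1/2)·log(β/β₀) ≈ 0.026` nats is INSIDE that slack, so the law is the continuum-limit
  (`β/β₀ → ∞` at fixed `β₀`, or fixed ratio with `L^d → ∞` against a fixed-capacity architecture)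
  statement; the sharp constant in front of `L^d` is Chatterjee's free-energy limit
  [arXiv:1602.01222 Thm 2.1], not claimed; `U(1)` / `U(N)` versions are
  `Theory2.Lattice.U1./UN.essM_between_law` (κ = 1, N²).
nearest_prior_art: the Haar-prior law `EntropyBudgetLaw` / `SU2.essM_volume_law_two` (this is its
  `β₀ > 0` form, previously `evasions_known (i)` in words); the mean-form `MeanContractionLaw`
  (finite space, with a variance correction); empirically, ESS-vs-volume degradation of transfer /
  annealed flows [arXiv:2211.07541 §IV; arXiv:2412.00200 §4.2] — no printed capacity law between
  couplings (THEORY-2.md §8 (40)).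
status: PROVED (`capacityRatioLaw`, from `Theory2.Lattice.SUN.essM_between_law`; 0 sorry). -/
def CapacityRatioLaw : Prop :=
  ∀ (d N : ℕ), 1 ≤ N →
    ∃ C : ℝ, ∀ (L : ℕ) [NeZero L], 2 ≤ L → ∀ β₀ β : ℝ, 1 ≤ β₀ → 1 ≤ β →
      ∀ (g : GaugeConfig d L (Matrix.specialUnitaryGroup (Fin N) ℂ) → ℝ) (J : ℝ),
        Measurable g → (∀ U, 0 < g U) →
        (∀ U, g U ≤ J / (partitionFunction (d := d) (L := L) (fundamentalRep (Fin N)) β₀).toReal) →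
          Theory2.essM (wilsonMeasure (d := d) (L := L) (fundamentalRep (Fin N)) β)
              ((Measure.pi fun _ : Edge d L =>
                  haarProbability (Matrix.specialUnitaryGroup (Fin N) ℂ)).withDensity
                fun U => ENNReal.ofReal (g U)) ≤
            J * Real.exp (C * (L : ℝ) ^ d) *
              β₀ ^ (((N : ℝ) ^ 2 - 1) * ((((d : ℝ) - 1) * (L : ℝ) ^ d + 1) / 2)) *
              β ^ (-(((N : ℝ) ^ 2 - 1) *
                (((d : ℝ) - 1) * (L : ℝ) ^ d * (1 / 2 - 1 / L) - 1 / 2)))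

/-- Discharge of `CapacityRatioLaw` by `Theory2.Lattice.SUN.essM_between_law`. -/
theorem capacityRatioLaw : CapacityRatioLaw :=
  fun d N hN => Theory2.Lattice.SUN.essM_between_law d N hN

/-- The `J = 1` reading (no Jacobian capacity — e.g. Haar-preserving rearrangements of the
`β₀`-ensemble, any depth): `ESS ≤ e^{C·L^d}·β₀^{(N²−1)((d−1)L^d+1)/2}·β^{−(N²−1)((d−1)L^d(1/2−1/L) − 1/2)}`. -/
theorem capacityRatioLaw_one (d N : ℕ) (hN : 1 ≤ N) :
    ∃ C : ℝ, ∀ (L : ℕ) [NeZero L], 2 ≤ L → ∀ β₀ β : ℝ, 1 ≤ β₀ → 1 ≤ β →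
      ∀ (g : GaugeConfig d L (Matrix.specialUnitaryGroup (Fin N) ℂ) → ℝ),
        Measurable g → (∀ U, 0 < g U) →
        (∀ U, g U ≤ ((partitionFunction (d := d) (L := L) (fundamentalRep (Fin N)) β₀).toReal)⁻¹) →
          Theory2.essM (wilsonMeasure (d := d) (L := L) (fundamentalRep (Fin N)) β)
              ((Measure.pi fun _ : Edge d L =>
                  haarProbability (Matrix.specialUnitaryGroup (Fin N) ℂ)).withDensity
                fun U => ENNReal.ofReal (g U)) ≤
            Real.exp (C * (L : ℝ) ^ d) *
              β₀ ^ (((N : ℝ) ^ 2 - 1) * ((((d : ℝ) - 1) * (L : ℝ) ^ d + 1) / 2)) *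
              β ^ (-(((N : ℝ) ^ 2 - 1) *
                (((d : ℝ) - 1) * (L : ℝ) ^ d * (1 / 2 - 1 / L) - 1 / 2))) :=
  Theory2.Lattice.SUN.essM_between_law_one d N hN

/-- The between-couplings law contains the Haar-prior law: at `β₀ = 1` (where `Z_Λ(1) ≤ 1`, so a
model of plain sup-density `J` qualifies) it is the volume × coupling law of
`Scaling/EntropyBudgetMeasureSU2.lean` with exponent `(N²−1)((d−1)L^d(1/2−1/L) − 1/2)`, for every
`N ≥ 1` and with no hypothesis. -/
theorem essM_volume_law_of_capacityRatioLaw (h : CapacityRatioLaw) (d N : ℕ) (hN : 1 ≤ N) :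
    ∃ C : ℝ, ∀ (L : ℕ) [NeZero L], 2 ≤ L → ∀ β : ℝ, 1 ≤ β →
      ∀ (g : GaugeConfig d L (Matrix.specialUnitaryGroup (Fin N) ℂ) → ℝ) (J : ℝ),
        Measurable g → (∀ U, 0 < g U) → (∀ U, g U ≤ J) →
          Theory2.essM (wilsonMeasure (d := d) (L := L) (fundamentalRep (Fin N)) β)
              ((Measure.pi fun _ : Edge d L =>
                  haarProbability (Matrix.specialUnitaryGroup (Fin N) ℂ)).withDensity
                fun U => ENNReal.ofReal (g U)) ≤
            J * Real.exp (C * (L : ℝ) ^ d) *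
              β ^ (-(((N : ℝ) ^ 2 - 1) *
                (((d : ℝ) - 1) * (L : ℝ) ^ d * (1 / 2 - 1 / L) - 1 / 2))) := by
  obtain ⟨C, hC⟩ := h d N hN
  refine ⟨C, fun L _ hL β hβ g J hg hg0 hgJ => ?_⟩
  have hZ1 : (partitionFunction (d := d) (L := L) (fundamentalRep (Fin N)) 1).toReal ≤ 1 := by
    have h1 := Theory2.Lattice.partitionFunction_le_one (d := d) (L := L) (fundamentalRep (Fin N))
      (Theory2.Lattice.SUN.re_trace_le N) zero_le_one
    simpa using ENNReal.toReal_mono ENNReal.one_ne_top h1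
  have hZpos : 0 < (partitionFunction (d := d) (L := L) (fundamentalRep (Fin N)) 1).toReal :=
    ENNReal.toReal_pos (Theory2.Lattice.partitionFunction_ne_zero (fundamentalRep (Fin N))
      (continuous_fundamentalRep (Fin N)) 1)
      (ne_top_of_le_ne_top ENNReal.one_ne_top
        (Theory2.Lattice.partitionFunction_le_one (fundamentalRep (Fin N))
          (Theory2.Lattice.SUN.re_trace_le N) zero_le_one))
  have hJ : 0 ≤ J := ((hg0 fun _ => 1).trans_le (hgJ fun _ => 1)).le
  have hgJ' : ∀ U, g U ≤
      J / (partitionFunction (d := d) (L := L) (fundamentalRep (Fin N)) 1).toReal := fun U =>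
    (hgJ U).trans (by rw [le_div_iff₀ hZpos]; exact mul_le_of_le_one_right hJ hZ1)
  have h := hC L hL 1 β le_rfl hβ g J hg hg0 hgJ'
  simpa only [Real.one_rpow, mul_one] using h

end Summit.Ventures.LatticeQCDFlow.Barriers
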